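import Mathlib.Algebra.Order.BigOperators.Group.Finset
import Mathlib.Algebra.BigOperators.Ring.Finset
import Mathlib.Algebra.Order.Group.Abs
import Mathlib.Data.Fintype.BigOperators
import Mathlib.Data.Fintype.Pi
import Mathlib.Data.Fintype.Prod
import Mathlib.Tactic.Linarith
import Mathlib.Tactic.Ring
import HarnessLib

/-!
# Yao's next-bit predictor (the hybrid argument), exact counting form

Literature / circuit complexity — pseudorandomness. For an arbitrary generator `G : S → {0,1}ᵐ` on a
finite seed set `S` and an arbitrary test `T : {0,1}ᵐ → {0,1}`, if `T` distinguishes `G`'s output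
from uniform then some output bit of `G` is predicted from the previous ones by the circuit-free
"Yao predictor" `w_j ⊕ ¬T(z_{<j}, w_j, w_{>j}) ⊕ sgn` for suitable fixed coins `w` and sign `sgn`
(A. C. Yao, FOCS 1982; the form of Nisan–Wigderson 1994, Lemma 2.4 / Arora–Barak 2009, Thm. 9.11
and proof of Thm. 20.10: distinguisher ⟹ next-bit predictor with advantage `ε/m`). Everything is
an identity or inequality between finite counts; no probability spaces, no circuits (the predictor is
`T` with some inputs fixed and possibly negated, which is what circuit-size bookkeeping consumes).

* `YaoNB.hybVec G j s w` — the `j`-th hybrid string (first `j` bits from `G s`, the rest from `w`);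
  `YaoNB.hybCount G T j` — the number of pairs `(s, w)` accepted by `T` on the `j`-th hybrid;
  `hybCount_zero` (`= |S| · #{w | T w}`), `hybCount_of_le` (`= #{s | T (G s)} · 2ᵐ`);
* `YaoNB.exists_gap` — **telescoping**: some consecutive pair of hybrids carries a `1/m` fraction of
  the total gap `|H_m − H_0|`;
* `YaoNB.pred T j sgn w z` — **Yao's predictor** of bit `j` from the prefix `z_{<j}`;
  `YaoNB.card_agree_add_hybCount` — the **exact identity** `#agree(sgn = 0) + H_j = H_{j+1} + |S|·2^{m-1}`
  (proof: split on `w_j = G(s)_j`, and pair `w` with `w` flipped at `j`);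
  `YaoNB.exists_sgn_card_agree_eq` — with the right sign, `#agree = |S|·2^{m-1} + |H_{j+1} − H_j|`;
* `YaoNB.yao_nextBit` — **Yao's lemma**: there are `j`, `sgn` and FIXED coins `w` with
  `2·|2ᵐ·#{s | T(G s)} − |S|·#{w | T w}| ≤ m · 2ᵐ · (2·#{s | pred = G(s)_j} − |S|)`, i.e. the
  predictor is right on a `≥ 1/2 + ε/m` fraction of the seeds when `T` has advantage `ε`.

Generic in `S`, `G`, `T`; the tree's `MetaComplexity/NWGenerator.lean` (hybrids of the
Nisan–Wigderson generator) and `MetaComplexity/DPHybrid.lean` (direct-product generator) prove the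
same argument for their specific generators. Stated for Umans' reconstruction (JCSS 2003, proof of
Lemma 13: "by Yao's argument there exists an `i` and a next-bit predictor"). No named fact.

## References

* A. C.-C. Yao, *Theory and applications of trapdoor functions*, FOCS 1982, 80–91 [Yao1982].
* N. Nisan, A. Wigderson, *Hardness vs randomness*, JCSS 49 (1994) 149–167, Lemma 2.4
  [NisanWigderson1994].
* S. Arora, B. Barak, *Computational Complexity: A Modern Approach*, CUP 2009, Thm. 9.11
  (unpredictability ⟹ pseudorandomness) and proof of Thm. 20.10 [AroraBarakCC2009].
* C. Umans, *Pseudo-random generators for all hardnesses*, JCSS 67 (2003), proof of Lemma 13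
  [Umans2003].
-/

namespace Literature.Computability.Complexity

open Finset

namespace YaoNB

variable {S : Type*} [Fintype S] {m : ℕ}

/-! ### Hybrids -/

/-- **The `j`-th hybrid string**: bit `i` is `G(s)_i` for `i < j` and the coin `w_i` for `i ≥ j`
(`j = 0`: all coins; `j ≥ m`: the output of `G`). [cite: NisanWigderson1994, Lemma 2.4 (proof, the
distributions `D_i`)] -/
def hybVec (G : S → Fin m → Bool) (j : ℕ) (s : S) (w : Fin m → Bool) : Fin m → Bool :=
  fun i => if (i : ℕ) < j then G s i else w i

/-- **The acceptance count of the `j`-th hybrid**: the number of pairs `(s, w)` with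
`T(hybVec G j s w) = 1`. [cite: NisanWigderson1994, Lemma 2.4 (proof, `p_i = Pr[C(D_i) = 1]`)] -/
def hybCount (G : S → Fin m → Bool) (T : (Fin m → Bool) → Bool) (j : ℕ) : ℕ :=
  #{p : S × (Fin m → Bool) | T (hybVec G j p.1 p.2) = true}

variable (G : S → Fin m → Bool) (T : (Fin m → Bool) → Bool)

omit [Fintype S] in
/-- The `0`-th hybrid is the coin string. [folklore] -/
@[simp] theorem hybVec_zero (s : S) (w : Fin m → Bool) : hybVec G 0 s w = w := by
  funext i; simp [hybVec]

omit [Fintype S] in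
/-- From `j ≥ m` on the hybrid is `G s`. [folklore] -/
theorem hybVec_of_le {j : ℕ} (h : m ≤ j) (s : S) (w : Fin m → Bool) : hybVec G j s w = G s := by
  funext i; simp [hybVec, lt_of_lt_of_le i.2 h]

/-- `H_0 = |S| · #{w | T w}`. [cite: NisanWigderson1994, Lemma 2.4 (proof, `p_0`)] -/
theorem hybCount_zero : hybCount G T 0 = Fintype.card S * #{w : Fin m → Bool | T w = true} := by
  unfold hybCount
  simp_rw [hybVec_zero]
  rw [show (univ.filter fun p : S × (Fin m → Bool) => T p.2 = true) =
      (univ : Finset S) ×ˢ (univ.filter fun w : Fin m → Bool => T w = true) by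
    ext p; simp]
  rw [card_product, card_univ]

/-- `H_j = #{s | T (G s)} · 2ᵐ` for `j ≥ m`. [cite: NisanWigderson1994, Lemma 2.4 (proof, `p_m`)] -/
theorem hybCount_of_le {j : ℕ} (h : m ≤ j) :
    hybCount G T j = #{s : S | T (G s) = true} * 2 ^ m := by
  unfold hybCount
  simp_rw [hybVec_of_le G h]
  rw [show (univ.filter fun p : S × (Fin m → Bool) => T (G p.1) = true) =
      (univ.filter fun s : S => T (G s) = true) ×ˢ (univ : Finset (Fin m → Bool)) by
    ext p; simp]
  rw [card_product, card_univ, Fintype.card_pi, prod_const, Fintype.card_bool, card_univ,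
    Fintype.card_fin]

/-- **Telescoping**: some consecutive pair of hybrids differs by at least a `1/m` fraction of
`|H_m − H_0|`. [cite: NisanWigderson1994, Lemma 2.4 (proof, "there is an `i` with
`p_i − p_{i-1} ≥ ε/m`")] -/
theorem exists_gap (hm : 0 < m) :
    ∃ j : Fin m, |(hybCount G T m : ℤ) - hybCount G T 0| ≤
      m * |(hybCount G T ((j : ℕ) + 1) : ℤ) - hybCount G T j| := by
  set f : Fin m → ℤ := fun j => |(hybCount G T ((j : ℕ) + 1) : ℤ) - hybCount G T j| with hf
  have hne : (univ : Finset (Fin m)).Nonempty := univ_nonempty_iff.2 ⟨⟨0, hm⟩⟩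
  obtain ⟨j, -, hj⟩ := exists_max_image univ f hne
  refine ⟨j, ?_⟩
  have htel : (hybCount G T m : ℤ) - hybCount G T 0 =
      ∑ i : Fin m, ((hybCount G T ((i : ℕ) + 1) : ℤ) - hybCount G T i) := by
    rw [Fin.sum_univ_eq_sum_range (fun i => (hybCount G T (i + 1) : ℤ) - hybCount G T i) m]
    exact (Finset.sum_range_sub (fun i => (hybCount G T i : ℤ)) m).symm
  calc |(hybCount G T m : ℤ) - hybCount G T 0|
      = |∑ i : Fin m, ((hybCount G T ((i : ℕ) + 1) : ℤ) - hybCount G T i)| := by rw [htel]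
    _ ≤ ∑ i : Fin m, |(hybCount G T ((i : ℕ) + 1) : ℤ) - hybCount G T i| := abs_sum_le_sum_abs _ _
    _ ≤ ∑ _i : Fin m, f j := sum_le_sum fun i _ => hj i (mem_univ i)
    _ = m * f j := by rw [sum_const, card_univ, Fintype.card_fin, nsmul_eq_mul]

/-! ### Yao's predictor and the exact agreement identity -/

/-- **Yao's predictor of bit `j` from the prefix**: fill position `j` with the coin `w_j` and the
positions above with `w`, run `T`; answer `w_j` if `T` accepts and `¬w_j` otherwise, then flip by the
sign `sgn` (only the bits `z_i`, `i < j`, of `z` are read). [cite: AroraBarakCC2009, Thm. 9.11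
(proof: "the algorithm … outputs `r` if `C` accepts and `1 − r` otherwise")] -/
def pred (T : (Fin m → Bool) → Bool) (j : Fin m) (sgn : Bool) (w z : Fin m → Bool) : Bool :=
  ((w j) ^^ !(T fun i => if (i : ℕ) < (j : ℕ) then z i else w i)) ^^ sgn

/-- **The agreement set**: the pairs `(s, w)` on which the predictor with coins `w` finds bit `j` of
`G s`. [cite: AroraBarakCC2009, Thm. 9.11 (proof)] -/
def agreeSet (G : S → Fin m → Bool) (T : (Fin m → Bool) → Bool) (j : Fin m) (sgn : Bool) :
    Finset (S × (Fin m → Bool)) :=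
  {p : S × (Fin m → Bool) | pred T j sgn p.2 (G p.1) = G p.1 j}

/-- Flipping coin `j`. [folklore] -/
def flipAt (j : Fin m) (w : Fin m → Bool) : Fin m → Bool := Function.update w j (!w j)

/-- Flipping twice is the identity. [folklore] -/
theorem flipAt_flipAt (j : Fin m) (w : Fin m → Bool) : flipAt j (flipAt j w) = w := by
  funext i
  by_cases h : i = j
  · subst h; simp [flipAt]
  · simp [flipAt, h]

/-- Coordinates of the flipped string. [folklore] -/
theorem flipAt_apply (j : Fin m) (w : Fin m → Bool) (i : Fin m) :
    flipAt j w i = if i = j then !w j else w i := by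
  by_cases h : i = j
  · subst h; simp [flipAt]
  · simp [flipAt, h]

/-- Complementary Booleans. [folklore] -/
theorem bnot_eq_of_ne {a b : Bool} (h : a ≠ b) : (!a) = b := by
  cases a <;> cases b <;> simp_all

omit [Fintype S] in
/-- The `(j+1)`-st hybrid does not read the coin `w_j`. [folklore] -/
theorem hybVec_succ_flipAt (j : Fin m) (s : S) (w : Fin m → Bool) :
    hybVec G ((j : ℕ) + 1) s (flipAt j w) = hybVec G ((j : ℕ) + 1) s w := by
  funext i
  simp only [hybVec, flipAt_apply]
  by_cases h : (i : ℕ) < (j : ℕ) + 1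
  · simp [h]
  · have hij : i ≠ j := fun e => by subst e; omega
    simp [h, hij]

omit [Fintype S] in
/-- When the coin `w_j` equals the real bit, the `j`-th and `(j+1)`-st hybrids coincide. [folklore] -/
theorem hybVec_eq_succ_of_eq (j : Fin m) (s : S) (w : Fin m → Bool) (h : w j = G s j) :
    hybVec G j s w = hybVec G ((j : ℕ) + 1) s w := by
  funext i
  simp only [hybVec]
  by_cases h1 : (i : ℕ) < (j : ℕ)
  · simp [h1, show (i : ℕ) < (j : ℕ) + 1 by omega]
  · by_cases h2 : (i : ℕ) < (j : ℕ) + 1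
    · have : i = j := Fin.ext (by omega)
      subst this; simp [h]
    · simp [h1, h2]

omit [Fintype S] in
/-- The test input of the predictor on the real prefix is the `j`-th hybrid. [folklore] -/
theorem pred_input_eq (j : Fin m) (s : S) (w : Fin m → Bool) :
    (fun i : Fin m => if (i : ℕ) < (j : ℕ) then G s i else w i) = hybVec G j s w := rfl

/-- **The exact agreement identity** (sign `0`): `#agree + H_j = H_{j+1} + |S| · 2^{m-1}` (for
`m ≥ 1`). On the pairs with `w_j = G(s)_j` the predictor is right iff `T` accepts the `j`-th (= the
`(j+1)`-st) hybrid; on the others iff `T` rejects the `j`-th hybrid; flipping `w_j` matches the two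
halves and does not change the `(j+1)`-st hybrid. [cite: AroraBarakCC2009, Thm. 9.11 (proof, the
computation of `Pr[A predicts]`); NisanWigderson1994, Lemma 2.4] -/
theorem card_agree_add_hybCount (j : Fin m) :
    2 * ((agreeSet G T j false).card + hybCount G T j) =
      2 * hybCount G T ((j : ℕ) + 1) + Fintype.card S * 2 ^ m := by
  classical
  -- the two halves `A` (coin = real bit) and `B`
  set A : Finset (S × (Fin m → Bool)) := {p | p.2 j = G p.1 j} with hA
  set B : Finset (S × (Fin m → Bool)) := {p | p.2 j ≠ G p.1 j} with hB
  set Tj : Finset (S × (Fin m → Bool)) := {p | T (hybVec G j p.1 p.2) = true} with hTj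
  set Tj1 : Finset (S × (Fin m → Bool)) := {p | T (hybVec G ((j : ℕ) + 1) p.1 p.2) = true} with hTj1
  -- the flip bijection
  let fl : S × (Fin m → Bool) → S × (Fin m → Bool) := fun p => (p.1, flipAt j p.2)
  have hfl_inv : ∀ p, fl (fl p) = p := fun p => by simp [fl, flipAt_flipAt]
  have hfl_inj : Function.Injective fl := fun p p' h => by rw [← hfl_inv p, h, hfl_inv]
  have hflA : A.image fl = B := by
    ext p
    simp only [mem_image, hA, hB, mem_filter, mem_univ, true_and, fl]
    constructor
    · rintro ⟨p', hp', rfl⟩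
      simp [flipAt_apply, hp']
    · intro hp
      refine ⟨fl p, ?_, hfl_inv p⟩
      simp only [fl, flipAt_apply, if_true]
      exact bnot_eq_of_ne hp
  have hflAT : (A ∩ Tj1).image fl = B ∩ Tj1 := by
    ext p
    simp only [mem_image, mem_inter, hA, hB, hTj1, mem_filter, mem_univ, true_and, fl]
    constructor
    · rintro ⟨p', ⟨hp'1, hp'2⟩, rfl⟩
      refine ⟨by simp [flipAt_apply, hp'1], ?_⟩
      simpa [hybVec_succ_flipAt] using hp'2
    · rintro ⟨hp1, hp2⟩
      refine ⟨fl p, ⟨?_, ?_⟩, hfl_inv p⟩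
      · simp only [fl, flipAt_apply, if_true]
        exact bnot_eq_of_ne hp1
      · simpa [fl, hybVec_succ_flipAt] using hp2
  have hcardAB : A.card = B.card := by rw [← hflA, card_image_of_injective _ hfl_inj]
  have hcardABT : (A ∩ Tj1).card = (B ∩ Tj1).card := by rw [← hflAT, card_image_of_injective _ hfl_inj]
  have hAB : A.card + B.card = Fintype.card S * 2 ^ m := by
    rw [hA, hB, Finset.card_filter_add_card_filter_not, card_univ, Fintype.card_prod, Fintype.card_pi,
      prod_const, Fintype.card_bool, card_univ, Fintype.card_fin]
  -- decompositions along `A ⊔ B`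
  have hsplit : ∀ X : Finset (S × (Fin m → Bool)), X.card = (A ∩ X).card + (B ∩ X).card := by
    intro X
    rw [hA, hB, ← Finset.card_filter_add_card_filter_not (fun p : S × (Fin m → Bool) => p.2 j = G p.1 j)]
    congr 1 <;> · congr 1; ext p; simp [mem_inter, mem_filter, and_comm]
  -- `#agree = |A ∩ Tj| + (|B| - |B ∩ Tj|)` and `A ∩ Tj = A ∩ Tj1`
  have hATj : A ∩ Tj = A ∩ Tj1 := by
    ext p
    simp only [mem_inter, hA, hTj, hTj1, mem_filter, mem_univ, true_and]
    constructor
    · rintro ⟨h1, h2⟩; exact ⟨h1, by rwa [← hybVec_eq_succ_of_eq G j p.1 p.2 h1]⟩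
    · rintro ⟨h1, h2⟩; exact ⟨h1, by rwa [hybVec_eq_succ_of_eq G j p.1 p.2 h1]⟩
  have hagA : A ∩ agreeSet G T j false = A ∩ Tj := by
    ext p
    simp only [mem_inter, hA, hTj, agreeSet, mem_filter, mem_univ, true_and, pred, pred_input_eq,
      Bool.xor_false]
    constructor
    · rintro ⟨h1, h2⟩
      refine ⟨h1, ?_⟩
      revert h1 h2
      cases T (hybVec G j p.1 p.2) <;> cases G p.1 j <;> cases p.2 j <;> simp
    · rintro ⟨h1, h2⟩
      refine ⟨h1, ?_⟩
      rw [h1, h2]; simp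
  have hagB : B ∩ agreeSet G T j false = B \ (B ∩ Tj) := by
    ext p
    simp only [mem_inter, mem_sdiff, hB, hTj, agreeSet, mem_filter, mem_univ, true_and, pred,
      pred_input_eq, Bool.xor_false, not_and]
    constructor
    · rintro ⟨h1, h2⟩
      refine ⟨h1, fun _ => ?_⟩
      revert h1 h2
      cases T (hybVec G j p.1 p.2) <;> cases G p.1 j <;> cases p.2 j <;> simp
    · rintro ⟨h1, h2⟩
      refine ⟨h1, ?_⟩
      have h3 := h2 h1
      revert h1 h3
      cases T (hybVec G j p.1 p.2) <;> cases G p.1 j <;> cases p.2 j <;> simp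
  have hcard_agree : (agreeSet G T j false).card = (A ∩ Tj1).card + (B.card - (B ∩ Tj).card) := by
    rw [hsplit (agreeSet G T j false), hagA, hATj, hagB, card_sdiff_of_subset inter_subset_left]
  have hBT_le : (B ∩ Tj).card ≤ B.card := card_le_card inter_subset_left
  have hHj : hybCount G T j = (A ∩ Tj1).card + (B ∩ Tj).card := by
    rw [hybCount, ← hTj, hsplit Tj, hATj]
  have hHj1 : hybCount G T ((j : ℕ) + 1) = (A ∩ Tj1).card + (B ∩ Tj1).card := by
    rw [hybCount, ← hTj1, hsplit Tj1]
  omega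

/-- The sign `1` predictor agrees exactly where the sign `0` predictor does not. [folklore] -/
theorem card_agree_true (j : Fin m) :
    (agreeSet G T j true).card + (agreeSet G T j false).card = Fintype.card S * 2 ^ m := by
  classical
  have hneg : ∀ w z : Fin m → Bool, pred T j true w z = !pred T j false w z := fun w z => by
    simp [pred]
  have : agreeSet G T j true = univ.filter fun p : S × (Fin m → Bool) => ¬ (pred T j false p.2 (G p.1) = G p.1 j) := by
    ext p
    simp only [agreeSet, mem_filter, mem_univ, true_and, hneg]
    cases pred T j false p.2 (G p.1) <;> cases G p.1 j <;> simp
  rw [this, agreeSet, add_comm, Finset.card_filter_add_card_filter_not, card_univ, Fintype.card_prod,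
    Fintype.card_pi, prod_const, Fintype.card_bool, card_univ, Fintype.card_fin]

/-- **With the right sign the predictor beats `1/2` by the hybrid gap**:
`2 · #agree(sgn) = |S| · 2ᵐ + 2 · |H_{j+1} − H_j|`. [cite: AroraBarakCC2009, Thm. 9.11 (proof)] -/
theorem exists_sgn_card_agree_eq (j : Fin m) :
    ∃ sgn : Bool, 2 * ((agreeSet G T j sgn).card : ℤ) =
      Fintype.card S * 2 ^ m + 2 * |(hybCount G T ((j : ℕ) + 1) : ℤ) - hybCount G T j| := by
  have h0 := card_agree_add_hybCount G T j
  have h1 := card_agree_true G T j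
  rcases le_total (hybCount G T j) (hybCount G T ((j : ℕ) + 1)) with hle | hle
  · refine ⟨false, ?_⟩
    have hle' : (hybCount G T j : ℤ) ≤ hybCount G T ((j : ℕ) + 1) := by exact_mod_cast hle
    rw [abs_of_nonneg (sub_nonneg.2 hle')]
    have : (2 : ℤ) * ((agreeSet G T j false).card + hybCount G T j) =
        2 * hybCount G T ((j : ℕ) + 1) + Fintype.card S * 2 ^ m := by exact_mod_cast h0
    linarith
  · refine ⟨true, ?_⟩
    have hle' : (hybCount G T ((j : ℕ) + 1) : ℤ) ≤ hybCount G T j := by exact_mod_cast hle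
    rw [abs_of_nonpos (sub_nonpos.2 hle')]
    have e0 : (2 : ℤ) * ((agreeSet G T j false).card + hybCount G T j) =
        2 * hybCount G T ((j : ℕ) + 1) + Fintype.card S * 2 ^ m := by exact_mod_cast h0
    have e1 : ((agreeSet G T j true).card : ℤ) + (agreeSet G T j false).card = Fintype.card S * 2 ^ m := by
      exact_mod_cast h1
    linarith

/-- **Fixing the coins**: some coin string does at least as well as the average over coins.
[cite: AroraBarakCC2009, Thm. 9.11 (proof, "we can hardwire the values")] -/
theorem exists_coins (j : Fin m) (sgn : Bool) :
    ∃ w : Fin m → Bool, (agreeSet G T j sgn).card ≤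
      2 ^ m * #{s : S | pred T j sgn w (G s) = G s j} := by
  classical
  set g : (Fin m → Bool) → ℕ := fun w => #{s : S | pred T j sgn w (G s) = G s j} with hg
  obtain ⟨w, -, hw⟩ := exists_max_image (univ : Finset (Fin m → Bool)) g ⟨fun _ => false, mem_univ _⟩
  refine ⟨w, ?_⟩
  have hsum : (agreeSet G T j sgn).card = ∑ w' : Fin m → Bool, g w' := by
    rw [card_eq_sum_card_fiberwise (s := agreeSet G T j sgn) (f := Prod.snd) (t := univ) fun _ _ => mem_univ _]
    refine sum_congr rfl fun w' _ => ?_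
    have hfib : (agreeSet G T j sgn).filter (fun p => p.2 = w') =
        (univ.filter fun s : S => pred T j sgn w' (G s) = G s j).map
          ⟨fun s => (s, w'), fun a b h => (Prod.ext_iff.1 h).1⟩ := by
      ext ⟨s, w''⟩
      simp only [agreeSet, mem_filter, mem_univ, true_and, mem_map, Function.Embedding.coeFn_mk,
        Prod.mk.injEq]
      constructor
      · rintro ⟨h1, rfl⟩; exact ⟨s, h1, rfl, rfl⟩
      · rintro ⟨s', h1, rfl, rfl⟩; exact ⟨h1, rfl⟩
    rw [hfib, card_map]
  rw [hsum]
  calc ∑ w' : Fin m → Bool, g w' ≤ ∑ _w' : Fin m → Bool, g w := sum_le_sum fun w' _ => hw w' (mem_univ _)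
    _ = 2 ^ m * g w := by
      rw [Finset.sum_const_nat (fun _ _ => rfl), card_univ, Fintype.card_pi, prod_const, Fintype.card_bool,
        card_univ, Fintype.card_fin]

/-- **Yao's next-bit lemma, counting form.** For every generator `G : S → {0,1}ᵐ` (`m ≥ 1`) and test
`T` there are a position `j`, a sign and fixed coins `w` such that Yao's predictor finds `G(s)_j` from
`G(s)_{<j}` on at least `|S| · (1/2 + ε/m)` seeds, where `ε = |Pr_s[T(G s)] − Pr_w[T w]|`:
`2 · |2ᵐ · #{s | T(G s)} − |S| · #{w | T w}| ≤ m · 2ᵐ · (2 · #{s | pred = G(s)_j} − |S|)`.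
(Yao 1982; the textbook form.) [cite: AroraBarakCC2009, Thm. 9.11; NisanWigderson1994, Lemma 2.4] -/
theorem yao_nextBit (hm : 0 < m) :
    ∃ (j : Fin m) (sgn : Bool) (w : Fin m → Bool),
      2 * |(2 : ℤ) ^ m * #{s : S | T (G s) = true} - (Fintype.card S : ℤ) * #{w : Fin m → Bool | T w = true}| ≤
        m * 2 ^ m * (2 * (#{s : S | pred T j sgn w (G s) = G s j} : ℤ) - Fintype.card S) := by
  obtain ⟨j, hj⟩ := exists_gap G T hm
  obtain ⟨sgn, hsgn⟩ := exists_sgn_card_agree_eq G T j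
  obtain ⟨w, hw⟩ := exists_coins G T j sgn
  refine ⟨j, sgn, w, ?_⟩
  have hH0 : (hybCount G T 0 : ℤ) = Fintype.card S * #{w : Fin m → Bool | T w = true} := by
    exact_mod_cast hybCount_zero G T
  have hHm : (hybCount G T m : ℤ) = 2 ^ m * #{s : S | T (G s) = true} := by
    rw [hybCount_of_le G T le_rfl]; push_cast; ring
  have hw' : ((agreeSet G T j sgn).card : ℤ) ≤ 2 ^ m * #{s : S | pred T j sgn w (G s) = G s j} := by
    exact_mod_cast hw
  have hm0 : (0 : ℤ) ≤ m := by positivity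
  rw [hHm, hH0] at hj
  nlinarith [hj, hsgn, hw', abs_nonneg ((hybCount G T ((j : ℕ) + 1) : ℤ) - hybCount G T j)]

end YaoNB

end Literature.Computability.Complexity
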